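import Summits.QuantumFields.YangMills.Theorems.BalabanUVNodesN12FlatStraightOntoGenSet
import Summits.QuantumFields.YangMills.Theorems.BalabanUVNodesN07CritMultiScaleLamBond
import Literature.MathematicalPhysics.QuantumFieldTheory.Balaban1983to89.Node00.MultiScaleFibreChart
import Summits.QuantumFields.YangMills.Theorems.BalabanUVNodesN12DirectSurjSharpDelta2
import Literature.MathematicalPhysics.QuantumFieldTheory.Balaban1983to89.B14Eq213DetSet

/-!
# DAG node N12 [B15] — (P4)′ road, step (T2): THE EXACT FOOTPRINT OF A SITE COLUMN AT THE RECORD's `𝐁_k(Z)` — a fine direction supported on bonds crossing the internal `n`-faces of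
# the block `B^{n+1}(y′)` of an INNER `(n+1)`-site `y′` moves NO constrained row of level `≤ n` and, at level `n+1`, only the rows at `y′` (true at EVERY configuration `U₀`)

Cell `pub-ymgap` (HUMAN RULINGS D-0062 ∕ D-0149), width seat `pub-ymgap-dag-n12-w6` g6 = the N12 (P4) clone by row (director-ym R463-ym; target = dag-n12-c g20's (P4)′ socket of record).
Key K1⁹ `stmt-QuantumFields-27364`, `--kind proof --supports … --as helper`; count-neutral; THEOREMS ONLY (0 `def`, 0 `sorry`).  Design note `HOME/pub-ymgap-dag-n12-w6/P4-DESIGN.md`.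

WHY.  In the block-triangular organisation of the (P4)′ surjectivity (`…N12DirectSurjTriangular`), the columns of the cluster at an inner `(n+1)`-site `y′` are the fine directions of
`…N12DirectSurjSiteBlockFlat` ∕ `…SiteBlockCurved`: supported on bonds `b` with `iterBlockOf (n+1) b± = y′` and DIFFERENT `n`-blocks.  Two-block locality of Bałaban's (0.4) (pv11's
`T4ReflectionConeSharp.twoBlockLocal_blockAvg`, iterated) says such a direction leaves `Ū^{j′}(c′)` unchanged unless BOTH `j′`-blocks of one of its bonds are end-points of `c′`; for
`j′ ≤ n` this forces both end-points of `c′` to have their centres in `B^{n+1}(y′) ⊂ Ω_{n+1}(Z)` (block union, [III] (2.13)), which no bond meeting `Γ_{j′}` has (`Γ_{j′} ⊂ Ω_{j′}∖Ω_{j′+1}`,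
`Γ₀ = Ω₁ᶜ`, [III] (2.2)); for `j′ = n + 1` it forces `y′ ∈ {c′₋, c′₊}`.  Hence the EXACT zero pattern needed on lower ranks — with no smallness.

CONTENTS.  §1 ★ `fderiv_msChart_apply_eq_zero_of_vanish_sharp` (a direction vanishing on the sharp tower of row `i` has `(DΨ(0)X)_i = 0`, any `𝐁`, any guarded `U₀` in the fibre).
§2 `not_mem_bondsOf_Bj_of_centres` (the [III] (2.2)∕(2.13) geometry).  §3 ★★★ `fderiv_msChart_apply_eq_zero_of_siteSupport` (the footprint at `𝐁_k(Z)`).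

HONEST FRAMING.  Support bookkeeping by name over landed kernel theorems; nothing of Bałaban's asserted; N12 NOT discharged; K1⁹ NOT closed; count-neutral (typed 28∕28 · discharged 5∕27
unmoved); R4 closes only the conditional finite-𝕋⁴ rung `BalabanLadder.UV`; the YM mass gap (Clay) is NOT proved by any of this.
-/

noncomputable section

open scoped BigOperators Matrix.Norms.L2Operator Topology
open Filter

namespace Summit.QuantumFields.YangMills.BalabanUVNodes.N12DirectSurjFootprint

open Literature.MathematicalPhysics.QuantumFieldTheory.Balaban1983to89
open T4Continuum (T4Family)
open T4ReflectionConeSharp (TwoBlockLocal twoBlockLocal_blockAvg)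
open T4AdjointCovarianceUnitary (lieSU expSU)
open B15DeterminingSets
open B14.Eq213DetSet (Bj maxDomT Bj_zero Bj_of_gt isBlockUnion_maxDomT maxDomT_antitone)
open B14.Eq213MaximalDomains (side)
open B5Eq118OneStroke (iterBlockOf iterBlockOf_zero iterBlockOf_succ)
open Node00
open Literature.MathematicalPhysics.QuantumFieldTheory.BalabanImbrieJaffe1984to88.BIJ88RT51Background (iterBlockOf_embIter)
open Summit.QuantumFields.YangMills.BalabanUVNodes.N07CritMultiScaleLamBond (iterBlockOf_congr_of_le)
open Summit.QuantumFields.YangMills.BalabanUVNodes.N12FlatStraightOntoGenSet (mem_iff_embIter_iterBlockOf_mem embIter_not_mem_succ_of_mem_genSet)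
open Summit.QuantumFields.YangMills.BalabanUVNodes.N12DirectSurjSharpDelta2 (iter_congr_of_twoBlockLocal avgFamily_congr_sharp)

/-! ## §1  A direction vanishing on the sharp tower of a row does not move that row -/


section Record

variable {F : T4Family} {N : ℕ} [NeZero N] {K k : ℕ}

/-- ★ **A DIRECTION VANISHING ON THE SHARP TOWER OF A ROW DOES NOT MOVE IT**: for `U₀` in the fibre of `W` with the guard below `k` and a constrained index `i ↔ (j, c)`, if `X b₀ = 0` at
every fine bond `b₀` with both end-points in `B^j(c₋) ∪ B^j(c₊)`, then `(DΨ_{𝐁,W,U₀}(0)X)_i = 0`: along the ray `tX` the `j`-fold average at `c` does not move (iterated two-block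
locality of (0.4)), so the `i`-th chart component is constant. [cite: Balaban1987RG1, (0.4) p.253; Balaban1988Convergent, (2.10)–(2.11) p.256; Balaban1985Variational, (82)–(83) p.290] -/
theorem fderiv_msChart_apply_eq_zero_of_vanish_sharp (hk : k ≤ (F.P K).m + (F.P K).K) {𝔹 : DetSet (F.P K)} {W : MSField (F.P K) (SU N)}
    {U₀ : GaugeField (F.P K) 0 (SU N)} (hU : AgreeOn 𝔹 (avgFamily (avOfRecord F N K) U₀) W) (hsb : SmallBelow (avOfRecord F N K) k U₀)
    (X : PBond (F.P K) 0 → lieSU (Fin N)) (i : Fin (constrCard 𝔹 k))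
    (hX : ∀ b₀ : PBond (F.P K) 0,
      (iterBlockOf (((constrEnum 𝔹 k).symm i).1 : ℕ) b₀.src = ((constrEnum 𝔹 k).symm i).2.1.src ∨
        iterBlockOf (((constrEnum 𝔹 k).symm i).1 : ℕ) b₀.src = ((constrEnum 𝔹 k).symm i).2.1.tgt) →
      (iterBlockOf (((constrEnum 𝔹 k).symm i).1 : ℕ) b₀.tgt = ((constrEnum 𝔹 k).symm i).2.1.src ∨
        iterBlockOf (((constrEnum 𝔹 k).symm i).1 : ℕ) b₀.tgt = ((constrEnum 𝔹 k).symm i).2.1.tgt) → X b₀ = 0) :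
    fderiv ℝ (msChart F N K k 𝔹 W U₀) 0 X i = 0 := by
  have hj : (((constrEnum 𝔹 k).symm i).1 : ℕ) ≤ (F.P K).m + (F.P K).K := (Nat.le_of_lt_succ ((constrEnum 𝔹 k).symm i).1.2).trans hk
  -- the `i`-th component is constant along the ray
  have hconst : ∀ t : ℝ, msChart F N K k 𝔹 W U₀ (t • X) i = msChart F N K k 𝔹 W U₀ 0 i := by
    intro t
    have havg : avgFamily (avOfRecord F N K) (expChart U₀ (t • X)) _ ((constrEnum 𝔹 k).symm i).2.1
        = avgFamily (avOfRecord F N K) U₀ _ ((constrEnum 𝔹 k).symm i).2.1 :=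
      iter_congr_of_twoBlockLocal (avOfRecord F N K) (fun _ => twoBlockLocal_blockAvg _) _ hj _ _ _ fun b₀ hs ht => by
        show U₀ b₀ * expSU ((t • X) b₀) = U₀ b₀
        rw [Pi.smul_apply, hX b₀ hs ht, smul_zero, Node00.expSU_zero, mul_one]
    rw [msChart_apply, msChart_apply, relAvg, relAvg, expChart_zero, havg]
  -- the derivative along the ray is the `i`-th component of `DΨ(0)X`, and also `0`
  have hray : HasDerivAt (fun t : ℝ => msChart F N K k 𝔹 W U₀ (t • X) i) (fderiv ℝ (msChart F N K k 𝔹 W U₀) 0 X i) 0 := by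
    have h := (hasStrictFDerivAt_msChart hU hsb).hasFDerivAt.comp_hasDerivAt_of_eq (0 : ℝ) (hasDerivAt_ray X) (zero_smul ℝ X).symm
    exact (hasDerivAt_pi.1 h) i
  have hzero : HasDerivAt (fun t : ℝ => msChart F N K k 𝔹 W U₀ (t • X) i) 0 0 := by
    have : (fun t : ℝ => msChart F N K k 𝔹 W U₀ (t • X) i) = fun _ => msChart F N K k 𝔹 W U₀ 0 i := funext hconst
    rw [this]
    exact hasDerivAt_const _ _
  exact hray.unique hzero

/-! ## §2  [III] (2.2)∕(2.13): a bond of level `≤ n` whose two end-points have their centres in the block of an inner `(n+1)`-site is unconstrained -/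

/-- The centre of the `j′`-block of a fine point lies in the same `n`-block (`j′ ≤ n ≤ m + K`). [cite: Balaban1987RG1, (0.1) p.251 (nested blocks)] -/
theorem iterBlockOf_embIter_iterBlockOf {j' n : ℕ} (hj'n : j' ≤ n) (hj' : j' ≤ (F.P K).m + (F.P K).K) (q : Site (F.P K) 0) :
    iterBlockOf n (embIter j' (iterBlockOf j' q)) = iterBlockOf n q :=
  iterBlockOf_congr_of_le hj'n (iterBlockOf_embIter j' hj' (iterBlockOf j' q))

/-- **UNCONSTRAINED SUB-BONDS.**  At the record's `𝐁_k(Z)` (`1 ≤ M₁`, `L^k·M₁ ∣ sitesPerDir 0`, `k ≤ m + K`): if `y′` is an INNER `(n+1)`-site (`embIter (n+1) y′ ∈ Ω_{n+1}(Z)`, `n + 1 ≤ k`) and a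
`j′`-bond `c′`, `j′ ≤ n`, has BOTH end-points' centres in `B^{n+1}(y′)` (as fine points), then `c′ ∉ bondsOf (𝐁_k(Z))_{j′}` — its end-points' centres lie in `Ω_{n+1} ⊆ Ω_{j′+1}` (block
union), whereas a bond meeting `Γ_{j′}` has an end-point with centre off `Ω_{j′+1}` (`1 ≤ j′`), resp. off `Ω₁` (`j′ = 0`). [cite: Balaban1988Convergent, (2.2) p.255, (2.13) pp.256–257] -/
theorem not_mem_bondsOf_Bj_of_centres {M₁ : ℕ} (hM : 1 ≤ M₁) {Z : Set (Site (F.P K) 0)} (hdiv : side (F.P K).L M₁ k ∣ (F.P K).sitesPerDir 0)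
    (hk : k ≤ (F.P K).m + (F.P K).K) {n : ℕ} (hn : n + 1 ≤ k) {y' : Site (F.P K) (n + 1)} (hy' : embIter (n + 1) y' ∈ maxDomT M₁ Z (n + 1))
    {j' : ℕ} (hj' : j' ≤ n) (c' : PBond (F.P K) j')
    (hs : iterBlockOf (n + 1) (embIter j' c'.src) = y') (ht : iterBlockOf (n + 1) (embIter j' c'.tgt) = y') :
    c' ∉ bondsOf (Bj M₁ Z k j') := by
  have hnK : n + 1 ≤ (F.P K).m + (F.P K).K := hn.trans hk
  have hBU : B14.Eq22Determines.IsBlockUnion (n + 1) (maxDomT M₁ Z (n + 1)) := isBlockUnion_maxDomT hM hdiv (by omega) hn hnK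
  -- both centres lie in `Ω_{n+1}`
  have hin : ∀ w : Site (F.P K) j', iterBlockOf (n + 1) (embIter j' w) = y' → embIter j' w ∈ maxDomT M₁ Z (n + 1) := fun w hw => by
    rw [mem_iff_embIter_iterBlockOf_mem hBU le_rfl hnK, hw]
    exact hy'
  have hsub : maxDomT M₁ Z (n + 1) ⊆ maxDomT M₁ Z (j' + 1) := maxDomT_antitone hM Z (by omega)
  intro hc'
  rcases Nat.eq_zero_or_pos j' with hj0 | hj0
  · subst hj0
    rw [Bj_zero (by omega)] at hc'
    rcases hc' with h | h
    · exact h (maxDomT_antitone hM Z (by omega) (hin _ hs))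
    · exact h (maxDomT_antitone hM Z (by omega) (hin _ ht))
  · rcases hc' with h | h
    · exact embIter_not_mem_succ_of_mem_genSet (maxDomT M₁ Z) (by omega) h (hsub (hin _ hs))
    · exact embIter_not_mem_succ_of_mem_genSet (maxDomT M₁ Z) (by omega) h (hsub (hin _ ht))

/-! ## §3  The footprint of a site column -/

/-- ★★★ **THE EXACT FOOTPRINT OF A SITE COLUMN.**  At `𝐁_k(Z)` (`1 ≤ M₁`, `L^k·M₁ ∣ sitesPerDir 0`, `k ≤ m + K`), for `U₀` in the fibre of `W` with the guard below `k`, an INNER `(n+1)`-site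
`y′` (`n + 1 ≤ k`) and a fine direction `X` supported on bonds `b` with `iterBlockOf (n+1) b₋ = iterBlockOf (n+1) b₊ = y′` and `iterBlockOf n b₋ ≠ iterBlockOf n b₊`: the component
`(DΨ(0)X)_i` VANISHES at every constrained index `i ↔ (j′, c′)` with `j′ ≤ n`, and at every `i` of level `n + 1` whose bond does not touch `y′` — at EVERY `U₀` (no smallness).
[cite: Balaban1987RG1, (0.4) p.253; Balaban1988Convergent, (2.2) p.255, (2.10)–(2.13) pp.256–257; Balaban1985Variational, (82)–(83) p.290] -/
theorem fderiv_msChart_apply_eq_zero_of_siteSupport {M₁ : ℕ} (hM : 1 ≤ M₁) {Z : Set (Site (F.P K) 0)} (hdiv : side (F.P K).L M₁ k ∣ (F.P K).sitesPerDir 0)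
    (hk : k ≤ (F.P K).m + (F.P K).K) {W : MSField (F.P K) (SU N)} {U₀ : GaugeField (F.P K) 0 (SU N)}
    (hU : AgreeOn (Bj M₁ Z k) (avgFamily (avOfRecord F N K) U₀) W) (hsb : SmallBelow (avOfRecord F N K) k U₀)
    {n : ℕ} (hn : n + 1 ≤ k) {y' : Site (F.P K) (n + 1)} (hy' : embIter (n + 1) y' ∈ maxDomT M₁ Z (n + 1))
    (X : PBond (F.P K) 0 → lieSU (Fin N))
    (hX : ∀ b : PBond (F.P K) 0, X b ≠ 0 → iterBlockOf (n + 1) b.src = y' ∧ iterBlockOf (n + 1) b.tgt = y' ∧ iterBlockOf n b.src ≠ iterBlockOf n b.tgt)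
    (i : Fin (constrCard (Bj M₁ Z k) k))
    (hi : (((constrEnum (Bj M₁ Z k) k).symm i).1 : ℕ) ≤ n ∨
      ((((constrEnum (Bj M₁ Z k) k).symm i).1 : ℕ) = n + 1 ∧
        embIter _ ((constrEnum (Bj M₁ Z k) k).symm i).2.1.src ≠ embIter (n + 1) y' ∧
        embIter _ ((constrEnum (Bj M₁ Z k) k).symm i).2.1.tgt ≠ embIter (n + 1) y')) :
    fderiv ℝ (msChart F N K k (Bj M₁ Z k) W U₀) 0 X i = 0 := by
  set s := (constrEnum (Bj M₁ Z k) k).symm i with hs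
  refine fderiv_msChart_apply_eq_zero_of_vanish_sharp hk hU hsb X i fun b₀ hbs hbt => ?_
  by_contra hb
  obtain ⟨hys, hyt, hne⟩ := hX b₀ hb
  have hj'K : ((s.1 : ℕ)) ≤ (F.P K).m + (F.P K).K := (Nat.le_of_lt_succ s.1.2).trans hk
  rcases hi with hle | ⟨heq, hns, hnt⟩
  · -- level `≤ n`: both end-points of the row have their centres in `B^{n+1}(y′)`, so the row is unconstrained — contradiction
    have hne' : iterBlockOf (s.1 : ℕ) b₀.src ≠ iterBlockOf (s.1 : ℕ) b₀.tgt := fun h => hne (iterBlockOf_congr_of_le hle h)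
    -- the two end-points of `s.2.1` are the two `s.1`-blocks of `b₀`
    have hends : ∀ w : Site (F.P K) s.1, (w = s.2.1.src ∨ w = s.2.1.tgt) →
        (w = iterBlockOf (s.1 : ℕ) b₀.src ∨ w = iterBlockOf (s.1 : ℕ) b₀.tgt) := by
      intro w hw
      rcases hbs with h1 | h1 <;> rcases hbt with h2 | h2
      · exact absurd (h1.trans h2.symm) hne'
      · rcases hw with rfl | rfl
        · exact Or.inl h1.symm
        · exact Or.inr h2.symm
      · rcases hw with rfl | rfl
        · exact Or.inr h2.symm
        · exact Or.inl h1.symm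
      · exact absurd (h1.trans h2.symm) hne'
    have hcentre : ∀ w : Site (F.P K) s.1, (w = s.2.1.src ∨ w = s.2.1.tgt) → iterBlockOf (n + 1) (embIter (s.1 : ℕ) w) = y' := by
      intro w hw
      rcases hends w hw with rfl | rfl
      · rw [iterBlockOf_embIter_iterBlockOf (by omega) hj'K]; exact hys
      · rw [iterBlockOf_embIter_iterBlockOf (by omega) hj'K]; exact hyt
    exact not_mem_bondsOf_Bj_of_centres hM hdiv hk hn hy' hle s.2.1 (hcentre _ (Or.inl rfl)) (hcentre _ (Or.inr rfl)) s.2.2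
  · -- level `n + 1`, row not touching `y′`: but `y′` is the `(n+1)`-block of `b₀₋`
    have key : ∀ w : Site (F.P K) s.1, iterBlockOf (s.1 : ℕ) b₀.src = w → embIter (s.1 : ℕ) w = embIter (n + 1) y' := by
      intro w hw
      have h1 : iterBlockOf (n + 1) (embIter (s.1 : ℕ) w) = iterBlockOf (n + 1) b₀.src := by
        rw [← hw]; exact iterBlockOf_embIter_iterBlockOf (le_of_eq heq) hj'K b₀.src
      rw [hys] at h1
      -- `s.1 = n+1`: the centre of an `(n+1)`-block determines it
      have h2 : iterBlockOf (n + 1) (embIter (n + 1) y') = y' := iterBlockOf_embIter (n + 1) (hn.trans hk) y'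
      have h3 : iterBlockOf (s.1 : ℕ) (embIter (s.1 : ℕ) w) = w := iterBlockOf_embIter _ hj'K w
      -- transport along `heq`
      have h4 : ∀ (m : ℕ) (hm : m = n + 1) (x : Site (F.P K) 0) (w' : Site (F.P K) m),
          iterBlockOf m x = w' → iterBlockOf (n + 1) x = y' → embIter m w' = embIter (n + 1) y' := by
        intro m hm x w' hx hy
        subst hm
        rw [← hx, hy]
      exact h4 _ heq (embIter (s.1 : ℕ) w) w h3 h1
    rcases hbs with h1 | h1
    · exact hns (key _ h1)
    · exact hnt (key _ h1)

end Record

end Summit.QuantumFields.YangMills.BalabanUVNodes.N12DirectSurjFootprint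

end
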